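import Summits.BirchSwinnertonDyer.BirchSwinnertonDyer.Theses.PrintX10b
import Summits.BirchSwinnertonDyer.BirchSwinnertonDyer.Theorems.ConjSpanGenAllLevels
import Summits.BirchSwinnertonDyer.BirchSwinnertonDyer.Theorems.PrintX8VerticalStevensIrreducible
import Summits.BirchSwinnertonDyer.BirchSwinnertonDyer.Theorems.PrintX10bAnalyticMuZeroX10bStubUnitMeasureOfNonconstancy
import Summits.BirchSwinnertonDyer.BirchSwinnertonDyer.Theorems.PrintX10bAnalyticMuZeroX10bStubMuAnZeroOfUnitMeasure
import Summits.BirchSwinnertonDyer.Rank1Residual.X10.ClassX10bLeaf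
import Summits.BirchSwinnertonDyer.Rank1Residual.X10.LeafDischargeX10b
import HarnessLib

set_option linter.dupNamespace false

/-!
# Route `PrintX10b`, crux `AnalyticMuZeroX10b` (stmt-BirchSwinnertonDyer-20682) — the EXACT RESIDUAL of LINE B, input-free:
# analytic μ₃ = 0 on class X10b follows from `G = E` in `SL₂(ℤ[1/3])` at the levels prime to 3, and from nothing else

The booked form of the crux (`AnalyticMuZeroX10bOfInputs`, stmt-22502, `Theorems/PrintX10bAnalyticMuZeroX10bOfInputs.lean`)
runs through THEOREM B at EVERY prime via the two published inputs (L) Morris 2007 ∧ (C) Serre 1970.  Read at the one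
prime the class uses, LINE B needs far less: Vaserstein's relative elementary statement for the SINGLE ring `ℤ[1/3]`,
«`G(ℤ[1/3], N·ℤ[1/3]) ≤ E(ℤ[1/3], N·ℤ[1/3])` for every `N ≥ 1` with `3 ∤ N`» (`ConjSpanGenAllLevels.RelGLeRelE 3 N`), gives
THEOREM B at `p = 3` by the orbit trick (`conjSpanGen_of_relGLeRelE'`, bsd-print-x8 p4), hence the non-constancy of the
3-power cyclotomic winding classes for every E with E[3] irreducible (`cycWindingNonConstantAt_of_irreducible_of_conjSpanGen`,
bsd-print-x8 p1), hence a unit value of the Mazur–Swinnerton-Dyer measure (stub 3a, p1) and a unit coefficient of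
`L_3(f, α_E)` (stub 3b, bsd-print-x9 p2).  So the UNCONDITIONAL text of stmt-20682 is closed by ONE input-free theorem
about `SL₂(ℤ[1/3])` — the target of the (K-b) port of the tree's `𝓞_F` road (files `CongruenceSubgroupPropertySL2Away*.lean`,
bsd-print-x8 ty2, in progress) specialised to `m = 3`.  No named fact is used in this file.
[cite: Vaserstein1972SL2, Thm. 3 / Lemma 1 (the relative elementary statement over rings with many units)]
[cite: Manin1972, Prop. 1.4 and Thm. 1.9 (winding classes span `pr Γ_H(N)`)]
-/

namespace Summit.BirchSwinnertonDyer.BirchSwinnertonDyer.Theorems.PrintX10bAnalyticMuZeroX10bOfRelGLeRelEThree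

open scoped Classical
open CongruenceSubgroup WeierstrassCurve
open Literature.NumberTheory.EllipticCurves
open Literature.NumberTheory.EllipticCurves.ModularForms
open Literature.NumberTheory.EllipticCurves.Rank1Residual
open Summit.BirchSwinnertonDyer.Rank1Residual.X10
open Summit.BirchSwinnertonDyer.BirchSwinnertonDyer.Cruxes.AnalyticMuZeroX10b.TheoremB
  (stub_unitMeasure_of_nonconstancy stub_muAnZero_of_unitMeasure)
open Summit.BirchSwinnertonDyer.BirchSwinnertonDyer.Theorems.ConjSpanGenAllLevels (RelGLeRelE conjSpanGen_of_relGLeRelE')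
open Summit.BirchSwinnertonDyer.BirchSwinnertonDyer.Theorems.PrintX8VerticalStevens
  (cycWindingNonConstantAt_of_irreducible_of_conjSpanGen)
open Summit.BirchSwinnertonDyer.BirchSwinnertonDyer.Theses.PrintX10b (AnalyticMuZeroX10b)

/-- **The exact input-free residual of the X10b μ-crux**: `G(ℤ[1/3], N ℤ[1/3]) ≤ E(ℤ[1/3], N ℤ[1/3])` for all
`N ≥ 1` prime to 3 ⟹ Greenberg's analytic μ₃ = 0 on class X10b (unit coefficient of `L_3(f, α_E)`).
[cite: Vaserstein1972SL2, Thm. 3 / Lemma 1] [cite: Manin1972, Prop. 1.4, Thm. 1.9] -/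
theorem analyticMuZeroX10b_of_relGLeRelE_three
    (hV : ∀ N : ℕ, 0 < N → ¬ 3 ∣ N → RelGLeRelE 3 N) : AnalyticMuZeroX10b := by
  intro W _ _ p _ N _ f hX _hns hf
  obtain ⟨rfl, -⟩ := id hX
  exact stub_muAnZero_of_unitMeasure W f hX.isOrdinaryAt_three hf hX.irr_three
    (stub_unitMeasure_of_nonconstancy W f hX.isOrdinaryAt_three hf hX.irr_three
      (cycWindingNonConstantAt_of_irreducible_of_conjSpanGen W 3 (by decide) hX.isOrdinaryAt_three.1 hX.irr_three
        fun M hM h3M => conjSpanGen_of_relGLeRelE' (by decide) h3M (hV M hM h3M)))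

end Summit.BirchSwinnertonDyer.BirchSwinnertonDyer.Theorems.PrintX10bAnalyticMuZeroX10bOfRelGLeRelEThree
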